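import Mathlib

/-!
# Crux H2 `BlochSeedDiscOne` — door (ii) COLOUR: the COLOUR-FORGETTING HALL LAW (hsemireg-colour-1 g1)

HONEST FRAMING. Crux workfile of the instrument seat `hsemireg-colour-1` (g1; cell `pub-hsemireg`, director-hodge block A6
door (ii) «COLOURED alphabet T2») for the crux H2 = stmt-HodgeConjecture-18881
`Summit.HodgeConjecture.HodgeConjecture.Theses.EightfoldBlochSeeds.BlochSeedDiscOne`. It is KERNEL COMBINATORICS ABOUT THE
CENSUS'S OWN BOOKKEEPING: the weighted bipartite HALL tests (UP ∕ DOWN ∕ JOINT, «Σ = ∅») that every LINE ∕ BAND ∕ monad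
design of record is screened with, and what a COLOURING of the alphabet (Pic⁰-labels on the cells, palette `r` per
(factor, letter), `⊥ ∈ {pinned, chain-dedicated}`) can and cannot do to them. Nothing here is a design, a monad, a sheaf, a
SOURCE or a SEED; NOTHING HERE SAYS THAT HC ∕ HC_CM ∕ HC_AV ∕ №4 ∕ 26512 ∕ H2 (18881) HOLDS OR FAILS. No `sorry`, no `axiom`,
no `instance`, no notation, no Literature fact; `import Mathlib` only. Machine ≠ kernel ≠ tree theorem: the hub rows quoted
in §2 are computations (logs named with digests), not theorems.

§1 THE ABSTRACT LAW (this file). A WEIGHTED BIPARTITE PATTERN is an arc relation `E : X → Y → Prop` (live arcs) with masses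
`m : X → R`, `n : Y → R` in an ordered additive monoid `R` (ℕ for SAT designs, ℤ ∕ ℚ for MILP ∕ LP designs). `nbhd E U` is the
neighbourhood `Γ_E(U)`; `Hall E m n := ∀ U, Σ_{x ∈ U} m x ≤ Σ_{y ∈ Γ_E(U)} n y` is the weighted Hall ∕ supply–demand condition
(= zero deficit of the transportation problem «ship all of `m` along live arcs into capacities `n`»; the census's UP test is
`X = A`-cells, `Y = N`-cells; DOWN is `X = C`, `Y = N` along the reversed DOWN arcs; JOINT is `X = A ⊕ C` with the shared
`N`-capacity — a `Sum` type, so the same definition). For a map of patterns `φ : Xc → X`, `ψ : Yc → Y` the PUSH-FORWARD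
`push φ mc x = Σ_{φ xc = x} mc xc` adds masses over fibres, and `ArcCompat Ec E φ ψ` says live arcs go to live arcs.
**`hall_push`** (THE LAW): `ArcCompat Ec E φ ψ → (0 ≤ nc) → Hall Ec mc nc → Hall E (push φ mc) (push ψ nc)` — Hall
feasibility is COVARIANT along arc-compatible maps; proof = fibrewise summation (`sum_push`) + `Γ_{Ec}(φ⁻¹U) ⊆ ψ⁻¹Γ_E(U)`
(`nbhd_pre_subset`) + monotonicity of nonnegative sums. Quantitative forms: **`violator_pre`** (a Hall violator `U` downstairs
pulls back to the violator `φ⁻¹U` upstairs), **`excess_push_le`** (in an ordered group: `excess_E(push mc, push nc; U) ≤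
excess_{Ec}(mc, nc; φ⁻¹U)` for every `U`, so the maximal deficit can only GROW upstairs), `hall_iff_excess_nonpos`, and the
`φ = id` case **`hall_mono_arcs`** (more live arcs ⇒ Hall easier; killing arcs — what a key-stratum divisor does — makes it harder).
§1e is a two-cell toy checked by `decide`: the converse fails (a colouring can CLOSE a Hall road, never OPEN one).

§2 THE TWO INSTANCES OF RECORD (dictionary to the census; alphabet T2 of `memo∕SPEC-CCHROMA-colour1-g0.md` 0951c534e6cc2078 §1).
(FORGET, finding F10 «COLOUR NEVER OPENS PLAIN HALL».) `Xc, Yc` = coloured cells (or coloured `G`-orbits, or their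
`S₃`-quotient classes — forgetting labels is `G`-equivariant, so each level is an instance), `X, Y` = letter cells (orbits,
classes), `φ, ψ` = forget the Pic⁰-labels, `Ec` = coloured live arcs. By T2 §1 a coloured arc is live only if its letter arc is
live (the coloured liveness table REFINES the letter table, for every palette size `r` and both `⊥` conventions), i.e.
`ArcCompat Ec E φ ψ`; and `push φ mc` is the uncoloured projection of the coloured design (the object on which (H1), rank, μ,
LC ∕ LF ∕ PO ∕ (R4) are read — Pic⁰-twists have trivial Chern character, so every CLASS-LEVEL row is colour-blind by
definition). Hence `hall_push`: a coloured design passing coloured plain Hall projects to a letter design passing letter plain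
Hall with the same class data; contrapositively EVERY plain-Hall ∕ orbit-Hall INFEASIBILITY word of record that quantifies over
all letter designs of a support with given class data (HALL₀, the two-term UP orbit-Hall thresholds `R_min`, RB-SCREEN8 ∕ D16
under (S-RB), TWOLEVEL-SCREEN at CLASS ⊗ ORBIT-HALL level, the Σ = ∅ rows of the design certificates) holds verbatim for every
coloured alphabet T2. Colour acts ONLY where the law is silent (§3).
(EMBED, finding F11 «LETTER DESIGNS ARE COLOURED DESIGNS».) The SAME theorem read with `φ = ι : X → Xc`, `ψ = κ : Y → Yc` the
inclusion of the letters as the all-label-0 layer: `push ι m` is the design RECOLOURED with all labels 0 (extension by zero),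
and `ArcCompat E Ec_test ι κ` holds for every coloured test whose arc set, restricted to the label-0 layer, contains the image of
a letter test the design passes — by T2 §1: the label-0 layer's liveness IS the letter liveness (both `⊥`); the coloured key
class `(1,0,β,0)` restricted to label-0 cells is the letter key class `(1,0,β)`; the classes `(1,0,β,±1)` kill NO arc between
label-0 cells (label differences vanish), so they reduce to Σ = ∅. Consequently a letter-level design passing Σ = ∅ and the
letter key strata 1 passes ALL `3·(h∕2)` coloured key classes at strata 1 as a coloured design: the questions C1 ∕ C2 ∕ C3-131 of
kit j332242 «CCHROMA-S131» v2 («does a coloured strata-1-clean (H1) design exist on S131, r = 2, ⊥ ∈ {pinned, dedicated}») are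
answered YES BY INCLUSION by s4-search-1 g29's letter-level KILLHALL v2.2b designs b45d82cc48fb823f (μ = +1 542 144 i) and
b59c325e71f8491f (μ = +771 072 i) on support fbe4f2dd13ec1059 (LINE 16), and CHROMA's «UNDECIDED after 60 lazy rounds» there was
loop non-convergence, not an obstruction. HUB CHECK (machine, not kernel; `kit-cchroma∕code∕chroma_check.py` 1b96651fa61aa095,
`--r 2 --level s3`, exact-integer max-flow): 5∕5 PASS — (H1) 0∕5 rows violated, rank 4, Σ = ∅ PASS, 24∕24 key classes PASS — logs
`hsemireg-colour-1∕logs∕check-KH22-{plainposim,hubcapposim}-label0-r2-{pinned,dedicated}-s3.log` (61fe15e5b403064e,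
0f988e95755c85e3, 38d03eb3016881d3, 986b9b46a322f6be) and `…-hubcapposim-label0-r2-dedicated-s3-hubcap.log` (b77e60334af24903).
These are rank-4 LINE objects, RETIRED AS DECIDERS by the LF GATE (director-hodge R19.257 (2)): the inclusion is a statement about
the instrument, not a rung.

§3 WHAT THE LAW DOES NOT COVER (finding F12, where colour still has teeth). For a GENUINELY coloured design and a key class with
`δ ≠ 0` (or `δ = 0` across different labels) the surviving-arc sets upstairs and downstairs are NOT related by `ArcCompat` in
either direction — the divisor kills label-dependent arcs — so neither instance applies: coloured key strata (KI ∕ KQ ∕ KJ at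
s ≥ 1), (B2) and L1 ∕ LKS are exactly the rows a colouring can change. The law is also silent on (LF) ∕ (R4), which are
class-level (colour-blind) and retire every rank-4 object regardless of colour.

Census-neutral; nothing toward 18881 ∕ H2 ∕ HC. hsemireg-colour-1 g1, 2026-08-29.
-/

set_option linter.dupNamespace false

namespace Summit.HodgeConjecture.HodgeConjecture.Cruxes.BlochSeedDiscOne.ColourForgetHall

open Finset

/-! ### §1a Weighted bipartite patterns and the Hall condition -/

section Pattern

variable {X Y : Type*} [Fintype Y] [DecidableEq Y]

/-- The neighbourhood `Γ_E(U)`: all `y` receiving a live arc from some `x ∈ U`. -/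
def nbhd (E : X → Y → Prop) [DecidableRel E] (U : Finset X) : Finset Y :=
  U.biUnion fun x => univ.filter fun y => E x y

theorem mem_nbhd {E : X → Y → Prop} [DecidableRel E] {U : Finset X} {y : Y} :
    y ∈ nbhd E U ↔ ∃ x ∈ U, E x y := by
  simp [nbhd]

/-- More live arcs ⇒ larger neighbourhoods. -/
theorem nbhd_mono_arcs {E E' : X → Y → Prop} [DecidableRel E] [DecidableRel E']
    (h : ∀ x y, E x y → E' x y) (U : Finset X) : nbhd E U ⊆ nbhd E' U := by
  intro y hy
  rw [mem_nbhd] at hy ⊢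
  obtain ⟨x, hx, hxy⟩ := hy
  exact ⟨x, hx, h x y hxy⟩

/-- Larger supply sets ⇒ larger neighbourhoods. -/
theorem nbhd_mono {E : X → Y → Prop} [DecidableRel E] {U V : Finset X} (h : U ⊆ V) :
    nbhd E U ⊆ nbhd E V := by
  intro y hy
  rw [mem_nbhd] at hy ⊢
  obtain ⟨x, hx, hxy⟩ := hy
  exact ⟨x, h hx, hxy⟩

variable {R : Type*} [AddCommMonoid R] [Preorder R]

/-- The weighted HALL condition of the pattern `(E, m, n)`: every supply set `U ⊆ X` is covered by the capacity of its
neighbourhood. (UP: `X = A`-cells, `Y = N`-cells; DOWN: `X = C`-cells along reversed DOWN arcs; JOINT: `X = A ⊕ C`.) -/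
def Hall (E : X → Y → Prop) [DecidableRel E] (m : X → R) (n : Y → R) : Prop :=
  ∀ U : Finset X, ∑ x ∈ U, m x ≤ ∑ y ∈ nbhd E U, n y

/-- `φ = id` case of the law: adding live arcs preserves Hall feasibility (nonnegative capacities); equivalently, KILLING
arcs — what a key-stratum divisor does to the pattern — can only create deficits. -/
theorem hall_mono_arcs [AddLeftMono R] {E E' : X → Y → Prop} [DecidableRel E] [DecidableRel E']
    (h : ∀ x y, E x y → E' x y) {m : X → R} {n : Y → R} (hn : ∀ y, 0 ≤ n y) (hH : Hall E m n) :
    Hall E' m n := fun U =>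
  (hH U).trans (sum_le_sum_of_subset_of_nonneg (nbhd_mono_arcs h U) fun y _ _ => hn y)

end Pattern

/-! ### §1b Push-forward of masses along a map of vertex sets -/

section Push

variable {Xc X : Type*} [Fintype Xc] [DecidableEq X]
variable {R : Type*} [AddCommMonoid R]

/-- Push-forward of a mass function along `φ`: the mass of `x` is the total mass of the fibre `φ⁻¹{x}`.
(FORGET: the uncoloured projection of a coloured design. EMBED: extension by zero of a letter design to the label-0 layer.) -/
def push (φ : Xc → X) (mc : Xc → R) (x : X) : R :=
  ∑ xc ∈ univ.filter (fun xc => φ xc = x), mc xc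

/-- The preimage `φ⁻¹U` as a finset. -/
def pre (φ : Xc → X) (U : Finset X) : Finset Xc :=
  univ.filter fun xc => φ xc ∈ U

theorem mem_pre {φ : Xc → X} {U : Finset X} {xc : Xc} : xc ∈ pre φ U ↔ φ xc ∈ U := by
  simp [pre]

/-- Fibrewise summation: the pushed-forward mass of `U` is the mass of `φ⁻¹U`. -/
theorem sum_push (φ : Xc → X) (mc : Xc → R) (U : Finset X) :
    ∑ x ∈ U, push φ mc x = ∑ xc ∈ pre φ U, mc xc := by
  have hmaps : ∀ xc ∈ pre φ U, φ xc ∈ U := fun xc hxc => mem_pre.1 hxc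
  rw [← sum_fiberwise_of_maps_to hmaps mc]
  refine sum_congr rfl fun x hx => ?_
  simp only [push]
  refine sum_congr ?_ fun _ _ => rfl
  ext xc
  simp only [pre, mem_filter, mem_univ, true_and]
  exact ⟨fun h => ⟨by rw [h]; exact hx, h⟩, fun h => h.2⟩

/-- Total mass is preserved by push-forward. -/
theorem sum_push_univ [Fintype X] (φ : Xc → X) (mc : Xc → R) :
    ∑ x, push φ mc x = ∑ xc, mc xc := by
  rw [sum_push]
  refine sum_congr ?_ fun _ _ => rfl
  ext xc
  simp [pre]

/-- Pushing forward along the identity does nothing. -/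
theorem push_id [DecidableEq Xc] (mc : Xc → R) : push id mc = mc := by
  funext x
  simp [push, Finset.filter_eq']

end Push

/-! ### §1c THE LAW: Hall feasibility is covariant along arc-compatible maps -/

section Law

variable {Xc Yc X Y : Type*} [Fintype Xc] [Fintype Yc] [Fintype Y] [DecidableEq X] [DecidableEq Y] [DecidableEq Yc]

/-- ARC COMPATIBILITY of a map of patterns `(φ, ψ) : (Xc, Yc, Ec) → (X, Y, E)`: live arcs go to live arcs.
(FORGET: the coloured liveness table T2 §1 refines the letter table. EMBED: the label-0 layer's liveness is the letter liveness.) -/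
def ArcCompat (Ec : Xc → Yc → Prop) (E : X → Y → Prop) (φ : Xc → X) (ψ : Yc → Y) : Prop :=
  ∀ xc yc, Ec xc yc → E (φ xc) (ψ yc)

variable {Ec : Xc → Yc → Prop} {E : X → Y → Prop} [DecidableRel Ec] [DecidableRel E] {φ : Xc → X} {ψ : Yc → Y}

/-- Upstairs neighbourhoods of preimages land in preimages of downstairs neighbourhoods: `Γ_{Ec}(φ⁻¹U) ⊆ ψ⁻¹ Γ_E(U)`. -/
theorem nbhd_pre_subset (hA : ArcCompat Ec E φ ψ) (U : Finset X) :
    nbhd Ec (pre φ U) ⊆ pre ψ (nbhd E U) := by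
  intro yc hyc
  rw [mem_pre, mem_nbhd]
  rw [mem_nbhd] at hyc
  obtain ⟨xc, hxc, hE⟩ := hyc
  exact ⟨φ xc, mem_pre.1 hxc, hA xc yc hE⟩

variable {R : Type*} [AddCommMonoid R] [Preorder R] [AddLeftMono R] {mc : Xc → R} {nc : Yc → R}

/-- Capacity comparison: the upstairs neighbourhood capacity of `φ⁻¹U` is at most the downstairs (pushed) capacity of `U`. -/
theorem sum_nbhd_pre_le (hA : ArcCompat Ec E φ ψ) (hn : ∀ yc, 0 ≤ nc yc) (U : Finset X) :
    ∑ yc ∈ nbhd Ec (pre φ U), nc yc ≤ ∑ y ∈ nbhd E U, push ψ nc y := by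
  rw [sum_push]
  exact sum_le_sum_of_subset_of_nonneg (nbhd_pre_subset hA U) fun yc _ _ => hn yc

/-- **THE COLOUR-FORGETTING HALL LAW.** Along an arc-compatible map of patterns with nonnegative capacities, Hall feasibility
upstairs implies Hall feasibility of the pushed-forward design downstairs. FORGET (F10): coloured plain Hall ⇒ letter plain
Hall of the uncoloured projection — colour never opens a closed plain-Hall road. EMBED (F11): letter Hall ⇒ coloured Hall of
the label-0 recolouring for every coloured test whose label-0 arcs contain the letter test's arcs. -/
theorem hall_push (hA : ArcCompat Ec E φ ψ) (hn : ∀ yc, 0 ≤ nc yc) (h : Hall Ec mc nc) :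
    Hall E (push φ mc) (push ψ nc) := fun U =>
  calc ∑ x ∈ U, push φ mc x = ∑ xc ∈ pre φ U, mc xc := sum_push φ mc U
    _ ≤ ∑ yc ∈ nbhd Ec (pre φ U), nc yc := h _
    _ ≤ ∑ y ∈ nbhd E U, push ψ nc y := sum_nbhd_pre_le hA hn U

/-- Contrapositive (the form the census uses): a plain-Hall INFEASIBILITY downstairs (for the projected masses) is an
infeasibility upstairs — for every colouring with that projection. -/
theorem not_hall_of_not_hall_push (hA : ArcCompat Ec E φ ψ) (hn : ∀ yc, 0 ≤ nc yc)
    (hfail : ¬ Hall E (push φ mc) (push ψ nc)) : ¬ Hall Ec mc nc :=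
  fun h => hfail (hall_push hA hn h)

/-- VIOLATOR TRANSFER: a Hall violator `U` downstairs pulls back to the Hall violator `φ⁻¹U` upstairs (the Farkas ∕ cut
certificate of record lifts verbatim to every colouring). -/
theorem violator_pre (hA : ArcCompat Ec E φ ψ) (hn : ∀ yc, 0 ≤ nc yc) {U : Finset X}
    (hU : ¬ ∑ x ∈ U, push φ mc x ≤ ∑ y ∈ nbhd E U, push ψ nc y) :
    ¬ ∑ xc ∈ pre φ U, mc xc ≤ ∑ yc ∈ nbhd Ec (pre φ U), nc yc :=
  fun h => hU ((sum_push φ mc U).le.trans (h.trans (sum_nbhd_pre_le hA hn U)))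

/-- Projection form: if `(mc, nc)` is ANY colouring of the letter design `(m, n)` (fibre masses add up to `m`, `n`) and the
letter design fails plain Hall, the coloured design fails plain Hall. -/
theorem not_hall_coloured_of_projection (hA : ArcCompat Ec E φ ψ) (hn : ∀ yc, 0 ≤ nc yc)
    {m : X → R} {n : Y → R} (hm : push φ mc = m) (hn' : push ψ nc = n) (hfail : ¬ Hall E m n) :
    ¬ Hall Ec mc nc := by
  subst hm hn'
  exact not_hall_of_not_hall_push hA hn hfail

end Law

/-! ### §1d Quantitative form in an ordered group: deficits only grow upstairs -/

section Excess

variable {Xc Yc X Y : Type*} [Fintype Xc] [Fintype Yc] [Fintype Y] [DecidableEq Y] [DecidableEq Yc]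
variable {R : Type*} [AddCommGroup R] [PartialOrder R] [IsOrderedAddMonoid R]

/-- The EXCESS (deficit) of a supply set: demand minus available neighbourhood capacity. `Hall ↔ ∀ U, excess U ≤ 0`. -/
def excess (E : X → Y → Prop) [DecidableRel E] (m : X → R) (n : Y → R) (U : Finset X) : R :=
  ∑ x ∈ U, m x - ∑ y ∈ nbhd E U, n y

theorem hall_iff_excess_nonpos {E : X → Y → Prop} [DecidableRel E] {m : X → R} {n : Y → R} :
    Hall E m n ↔ ∀ U, excess E m n U ≤ 0 := by
  simp [Hall, excess]

variable [DecidableEq X] {Ec : Xc → Yc → Prop} {E : X → Y → Prop} [DecidableRel Ec] [DecidableRel E]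
  {φ : Xc → X} {ψ : Yc → Y} {mc : Xc → R} {nc : Yc → R}

/-- For every downstairs supply set `U`, the downstairs excess of the pushed design is at most the upstairs excess of `φ⁻¹U`:
the maximal Hall deficit of a coloured design is ≥ that of its uncoloured projection. -/
theorem excess_push_le (hA : ArcCompat Ec E φ ψ) (hn : ∀ yc, 0 ≤ nc yc) (U : Finset X) :
    excess E (push φ mc) (push ψ nc) U ≤ excess Ec mc nc (pre φ U) := by
  unfold excess
  rw [sum_push]
  exact sub_le_sub_left (sum_nbhd_pre_le hA hn U) _

/-- Hence an excess lower bound certified downstairs (e.g. «max deficit ≥ 7∕2» of a FLOWLP core, or the `R_min` two-term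
thresholds) is a lower bound upstairs for every colouring with that projection. -/
theorem excess_lower_bound_lifts (hA : ArcCompat Ec E φ ψ) (hn : ∀ yc, 0 ≤ nc yc) {c : R} {U : Finset X}
    (hc : c ≤ excess E (push φ mc) (push ψ nc) U) : c ≤ excess Ec mc nc (pre φ U) :=
  hc.trans (excess_push_le hA hn U)

end Excess

/-! ### §1e Two-cell toy, machine-checked by `decide`: the law is ONE-DIRECTIONAL

One `A`-letter and one `N`-letter, each in two colours; a coloured `A`-cell meets only the `N`-cell of its own label (the
shape of a label-sensitive key-stratum test, §3). With masses `A`: 1 + 1 and `N`: 2 + 0 the COLOURED pattern FAILS Hall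
(the label-`false` cell has no capacity) while its uncoloured projection (`A`: 2, `N`: 2, one live arc) PASSES: colour can
CLOSE a Hall road — this is where coloured key strata get their teeth — but by `hall_push` it can never OPEN one. -/

section Toy

example : ¬ Hall (fun b b' : Bool => b = b') (fun _ : Bool => (1 : ℕ)) (fun b : Bool => if b then 2 else 0) := by
  unfold Hall nbhd; decide

example : Hall (fun _ _ : Unit => True) (push (fun _ : Bool => ()) (fun _ : Bool => (1 : ℕ)))
    (push (fun _ : Bool => ()) (fun b : Bool => if b then 2 else 0)) := by
  unfold Hall nbhd push; decide

/-- The toy map (forget the label) IS arc-compatible, so `hall_push` applies to it: Hall is transported DOWN along it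
(coloured ⇒ letter), and the first example shows it is not transported UP. -/
example : ArcCompat (fun b b' : Bool => b = b') (fun _ _ : Unit => True) (fun _ => ()) (fun _ => ()) :=
  fun _ _ _ => trivial

end Toy

end Summit.HodgeConjecture.HodgeConjecture.Cruxes.BlochSeedDiscOne.ColourForgetHall
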